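import Literature.NumberTheory.LFunctions.DirichletLFunctionBounds
import Literature.NumberTheory.LFunctions.DirichletLogDerivDisc
import HarnessLib

/-!
# RiemannHypothesis / LiDirichletAsymptotic — two numerical constants of the tree's zero-counting remainder
# (`ζ(5/4) ≤ 4.6`, `2/log(7/6) ≤ 12.975`; RH-FREE · GRH-FREE)

RH-FREE · GRH-FREE PROOF-OF-DATA (rung L-P(P1⁺χ)) [rh-li-prover].  Route `Theses/LiDirichletAsymptotic.lean`
(cell `pub/rh-li`), shared by the items `LiOscillatoryChar` / `LiLowZerosChar` / `LiFarTailsChar`: the tree's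
RH-free two-sided counting remainder for `L(s, χ)` (`DirichletTheta.abs_lfunctionZeroCount_sub_le`) is
`5 + 2 log(2 ζ(5/4) q (T+4))/log(7/6)` with `ζ(5/4) = DirichletDisc.Zc = ∑ (n+1)^{−5/4}`, while the route's
vocabulary types it as `argSRem q t = 5 + 12.975 log(9.1902 q (t+4))`.  Here the two numerical facts that
relate them are PROVED:

* `two_div_log_seven_sixths_le`: `2/log(7/6) ≤ 12.975` (series of `−log(1 − 1/7)` to seven terms,
  `Real.abs_log_sub_add_sum_range_le`; the true value is `12.9743…`);
* `Zc_le`: `ζ(5/4) ≤ 4.6` (`1 + 2^{−5/4} + 3^{−5/4}` plus the tail `∑_{m ≥ 4} m^{−5/4} ≤ ∫_{7/2}^∞ x^{−5/4} dx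
  = 4·(7/2)^{−1/4}` by the MIDPOINT inequality `m^{−5/4} ≤ ∫_{m−½}^{m+½} x^{−5/4} dx` (AM–GM on
  `(m−u)^{−5/4} + (m+u)^{−5/4}`); the true value is `4.5951…`);

hence `5 + 2 log(2 Zc X)/log(7/6) ≤ argSRem-shape + 0.014` (`remainder_le`).  Nothing here bears on RH or GRH.
-/

noncomputable section

-- D-0017: `Summit.<S>.<S>.…` is the designed namespace of a single-problem summit.
set_option linter.dupNamespace false

open MeasureTheory intervalIntegral Set Finset

namespace Summit.RiemannHypothesis.RiemannHypothesis.Theorems.LiTheory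

open Literature.NumberTheory.LFunctions

namespace CharCount

/-! ### `2/log(7/6) ≤ 12.975` -/

/-- `log(7/6) ≥ 0.15415` (seven terms of `∑ 7^{−k}/k` with the tree-free Mathlib remainder bound). -/
theorem log_seven_sixths_ge : (0.15415 : ℝ) ≤ Real.log (7 / 6) := by
  have hx : |(1 / 7 : ℝ)| < 1 := by rw [abs_of_pos (by norm_num)]; norm_num
  have h := Real.abs_log_sub_add_sum_range_le hx 7
  have e : Real.log (1 - 1 / 7) = -Real.log (7 / 6) := by
    rw [show (1 : ℝ) - 1 / 7 = (7 / 6)⁻¹ by norm_num, Real.log_inv]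
  rw [e, abs_of_pos (by norm_num : (0 : ℝ) < 1 / 7)] at h
  have h2 := (abs_le.1 h).2
  simp only [Finset.sum_range_succ, Finset.sum_range_zero] at h2
  norm_num at h2
  linarith

/-- **`2/log(7/6) ≤ 12.975`** (the constant of `argSRem`; true value `12.9743…`). -/
theorem two_div_log_seven_sixths_le : 2 / Real.log (7 / 6) ≤ 12.975 := by
  have h := log_seven_sixths_ge
  rw [div_le_iff₀ (by linarith)]
  linarith

/-! ### `ζ(5/4) ≤ 4.6` -/

/-- `2^{−5/4} ≤ 0.4205`. -/
theorem two_rpow_le : (2 : ℝ) ^ (-(5 / 4 : ℝ)) ≤ 0.4205 := by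
  refine (pow_le_pow_iff_left₀ (by positivity) (by norm_num) (by norm_num : (4 : ℕ) ≠ 0)).1 ?_
  rw [← Real.rpow_natCast, ← Real.rpow_mul (by norm_num),
    show (-(5 / 4 : ℝ)) * ((4 : ℕ) : ℝ) = ((-5 : ℤ) : ℝ) by norm_num, Real.rpow_intCast]
  norm_num

/-- `3^{−5/4} ≤ 0.2535`. -/
theorem three_rpow_le : (3 : ℝ) ^ (-(5 / 4 : ℝ)) ≤ 0.2535 := by
  refine (pow_le_pow_iff_left₀ (by positivity) (by norm_num) (by norm_num : (4 : ℕ) ≠ 0)).1 ?_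
  rw [← Real.rpow_natCast, ← Real.rpow_mul (by norm_num),
    show (-(5 / 4 : ℝ)) * ((4 : ℕ) : ℝ) = ((-5 : ℤ) : ℝ) by norm_num, Real.rpow_intCast]
  norm_num

/-- `(7/2)^{−1/4} ≤ 0.7312`. -/
theorem seven_halves_rpow_le : (7 / 2 : ℝ) ^ (-(1 / 4 : ℝ)) ≤ 0.7312 := by
  refine (pow_le_pow_iff_left₀ (by positivity) (by norm_num) (by norm_num : (4 : ℕ) ≠ 0)).1 ?_
  rw [← Real.rpow_natCast, ← Real.rpow_mul (by norm_num),
    show (-(1 / 4 : ℝ)) * ((4 : ℕ) : ℝ) = ((-1 : ℤ) : ℝ) by norm_num, Real.rpow_intCast]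
  norm_num

/-- AM–GM for the power `−5/4`: `(m−u)^{−5/4} + (m+u)^{−5/4} ≥ 2 m^{−5/4}` for `0 ≤ u < m`. -/
theorem two_mul_rpow_le_add {m u : ℝ} (hu : 0 ≤ u) (hum : u < m) :
    2 * m ^ (-(5 / 4 : ℝ)) ≤ (m - u) ^ (-(5 / 4 : ℝ)) + (m + u) ^ (-(5 / 4 : ℝ)) := by
  have hm : 0 < m := lt_of_le_of_lt hu hum
  have h1 : 0 < m - u := by linarith
  have h2 : 0 < m + u := by linarith
  set A := (m - u) ^ (-(5 / 4 : ℝ)) with hA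
  set B := (m + u) ^ (-(5 / 4 : ℝ)) with hB
  have hA0 : 0 ≤ A := by positivity
  have hB0 : 0 ≤ B := by positivity
  -- `2 √A √B ≤ A + B`
  have hag : 2 * (Real.sqrt A * Real.sqrt B) ≤ A + B := by
    have h := two_mul_le_add_sq (Real.sqrt A) (Real.sqrt B)
    rw [Real.sq_sqrt hA0, Real.sq_sqrt hB0] at h
    linarith
  -- `√A √B = ((m−u)(m+u))^{−5/8} ≥ (m²)^{−5/8} = m^{−5/4}`
  have hprod : Real.sqrt A * Real.sqrt B = ((m - u) * (m + u)) ^ (-(5 / 8 : ℝ)) := by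
    rw [← Real.sqrt_mul hA0, hA, hB, ← Real.mul_rpow h1.le h2.le, Real.sqrt_eq_rpow,
      ← Real.rpow_mul (by positivity)]
    norm_num
  have hmono : (m ^ 2) ^ (-(5 / 8 : ℝ)) ≤ ((m - u) * (m + u)) ^ (-(5 / 8 : ℝ)) :=
    Real.rpow_le_rpow_of_nonpos (by positivity) (by nlinarith) (by norm_num)
  have hsq : (m ^ 2) ^ (-(5 / 8 : ℝ)) = m ^ (-(5 / 4 : ℝ)) := by
    rw [show m ^ 2 = m ^ ((2 : ℕ) : ℝ) by rw [Real.rpow_natCast], ← Real.rpow_mul hm.le]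
    norm_num
  rw [hprod] at hag
  linarith [hmono, hsq]

/-- **The midpoint inequality** for `x^{−5/4}`: `m^{−5/4} ≤ 4((m−½)^{−1/4} − (m+½)^{−1/4}) = ∫_{m−½}^{m+½} x^{−5/4} dx`
for `m ≥ 1` (convexity, via `two_mul_rpow_le_add`). -/
theorem rpow_le_telescope {m : ℝ} (hm : 1 ≤ m) :
    m ^ (-(5 / 4 : ℝ)) ≤ 4 * ((m - 1 / 2) ^ (-(1 / 4 : ℝ)) - (m + 1 / 2) ^ (-(1 / 4 : ℝ))) := by
  have hm0 : 0 < m := by linarith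
  have hlo : 0 < m - 1 / 2 := by linarith
  -- the integral of `x^{−5/4}` over `[m − ½, m + ½]`
  have hI : ∫ x in (m - 1 / 2)..(m + 1 / 2), x ^ (-(5 / 4 : ℝ)) =
      4 * ((m - 1 / 2) ^ (-(1 / 4 : ℝ)) - (m + 1 / 2) ^ (-(1 / 4 : ℝ))) := by
    rw [integral_rpow (Or.inr ⟨by norm_num, by
      rw [Set.uIcc_of_le (by linarith)]; exact fun h ↦ by linarith [h.1]⟩)]
    norm_num
    ring
  rw [← hI]
  -- split at `m` and substitute `x = m ∓ u`
  have hcont : ∀ a b : ℝ, 0 < a → a ≤ b →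
      IntervalIntegrable (fun x : ℝ ↦ x ^ (-(5 / 4 : ℝ))) volume a b := by
    intro a b ha hab
    refine ContinuousOn.intervalIntegrable (continuousOn_of_forall_continuousAt fun x hx ↦ ?_)
    rw [Set.uIcc_of_le hab] at hx
    have : x ≠ 0 := (lt_of_lt_of_le ha hx.1).ne'
    exact Real.continuousAt_rpow_const _ _ (Or.inl this)
  rw [← integral_add_adjacent_intervals (hcont _ m hlo (by linarith)) (hcont m _ hm0 (by linarith))]
  have h1 : ∫ x in (m - 1 / 2)..m, x ^ (-(5 / 4 : ℝ)) = ∫ u in (0 : ℝ)..1 / 2, (m - u) ^ (-(5 / 4 : ℝ)) := by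
    rw [intervalIntegral.integral_comp_sub_left (fun x : ℝ ↦ x ^ (-(5 / 4 : ℝ))) m]
    simp
  have h2 : ∫ x in m..(m + 1 / 2), x ^ (-(5 / 4 : ℝ)) = ∫ u in (0 : ℝ)..1 / 2, (m + u) ^ (-(5 / 4 : ℝ)) := by
    rw [intervalIntegral.integral_comp_add_left (fun x : ℝ ↦ x ^ (-(5 / 4 : ℝ))) m]
    simp
  rw [h1, h2]
  have hi1 : IntervalIntegrable (fun u : ℝ ↦ (m - u) ^ (-(5 / 4 : ℝ))) volume 0 (1 / 2) := by
    refine ContinuousOn.intervalIntegrable (continuousOn_of_forall_continuousAt fun u hu ↦ ?_)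
    rw [Set.uIcc_of_le (by norm_num)] at hu
    have : m - u ≠ 0 := by linarith [hu.2]
    exact (Real.continuousAt_rpow_const _ _ (Or.inl this)).comp (by fun_prop)
  have hi2 : IntervalIntegrable (fun u : ℝ ↦ (m + u) ^ (-(5 / 4 : ℝ))) volume 0 (1 / 2) := by
    refine ContinuousOn.intervalIntegrable (continuousOn_of_forall_continuousAt fun u hu ↦ ?_)
    rw [Set.uIcc_of_le (by norm_num)] at hu
    have : m + u ≠ 0 := by linarith [hu.1]
    exact (Real.continuousAt_rpow_const _ _ (Or.inl this)).comp (by fun_prop)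
  rw [← intervalIntegral.integral_add hi1 hi2]
  calc m ^ (-(5 / 4 : ℝ)) = ∫ _ in (0 : ℝ)..1 / 2, 2 * m ^ (-(5 / 4 : ℝ)) := by
        rw [intervalIntegral.integral_const]; simp
    _ ≤ ∫ u in (0 : ℝ)..1 / 2, (m - u) ^ (-(5 / 4 : ℝ)) + (m + u) ^ (-(5 / 4 : ℝ)) :=
        intervalIntegral.integral_mono_on (by norm_num) intervalIntegrable_const (hi1.add hi2)
          fun u hu ↦ two_mul_rpow_le_add hu.1 (by linarith [hu.2])

/-- The tail `∑_{m ≥ 4} m^{−5/4} ≤ 4 · (7/2)^{−1/4}` (telescoping the midpoint inequality). -/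
theorem tsum_tail_le :
    ∑' i : ℕ, ((i + 4 : ℕ) : ℝ) ^ (-(5 / 4 : ℝ)) ≤ 4 * (7 / 2 : ℝ) ^ (-(1 / 4 : ℝ)) := by
  set T : ℕ → ℝ := fun i ↦ 4 * (((i + 4 : ℕ) : ℝ) - 1 / 2) ^ (-(1 / 4 : ℝ)) with hT
  have hT0 : ∀ i, 0 ≤ T i := fun i ↦ by
    simp only [hT]
    have : (0 : ℝ) < ((i + 4 : ℕ) : ℝ) - 1 / 2 := by push_cast; linarith [(i.cast_nonneg : (0 : ℝ) ≤ i)]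
    positivity
  have hstep : ∀ i : ℕ, ((i + 4 : ℕ) : ℝ) ^ (-(5 / 4 : ℝ)) ≤ T i - T (i + 1) := by
    intro i
    have hi : (1 : ℝ) ≤ ((i + 4 : ℕ) : ℝ) := by push_cast; linarith [(i.cast_nonneg : (0 : ℝ) ≤ i)]
    have h := rpow_le_telescope hi
    have e : T (i + 1) = 4 * (((i + 4 : ℕ) : ℝ) + 1 / 2) ^ (-(1 / 4 : ℝ)) := by
      simp only [hT]; push_cast; ring_nf
    rw [e]
    simp only [hT]
    linarith
  refine Real.tsum_le_of_sum_range_le (fun i ↦ by positivity) fun N ↦ ?_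
  calc ∑ i ∈ range N, ((i + 4 : ℕ) : ℝ) ^ (-(5 / 4 : ℝ)) ≤ ∑ i ∈ range N, (T i - T (i + 1)) :=
        Finset.sum_le_sum fun i _ ↦ hstep i
    _ = T 0 - T N := by
        rw [Finset.sum_range_sub' ]
    _ ≤ T 0 := by linarith [hT0 N]
    _ = 4 * (7 / 2 : ℝ) ^ (-(1 / 4 : ℝ)) := by simp only [hT]; norm_num

/-- **`ζ(5/4) = DirichletDisc.Zc ≤ 4.6`** (`1 + 2^{−5/4} + 3^{−5/4} + 4(7/2)^{−1/4} ≤ 4.5988`; true value `4.5951…`). -/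
theorem Zc_le : DirichletDisc.Zc ≤ 4.6 := by
  have hsum : Summable fun n : ℕ ↦ ((n + 1 : ℕ) : ℝ) ^ (-(5 / 4 : ℝ)) := by
    have := DirichletAbel.summable_rpow_neg (σ := 1 / 4) (by norm_num)
    convert this using 2; norm_num
  unfold DirichletDisc.Zc
  rw [← hsum.sum_add_tsum_nat_add 3]
  have hhead : ∑ i ∈ range 3, ((i + 1 : ℕ) : ℝ) ^ (-(5 / 4 : ℝ)) =
      1 + (2 : ℝ) ^ (-(5 / 4 : ℝ)) + (3 : ℝ) ^ (-(5 / 4 : ℝ)) := by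
    simp only [Finset.sum_range_succ, Finset.sum_range_zero]
    norm_num
  have htail : ∑' i : ℕ, ((i + 3 + 1 : ℕ) : ℝ) ^ (-(5 / 4 : ℝ)) = ∑' i : ℕ, ((i + 4 : ℕ) : ℝ) ^ (-(5 / 4 : ℝ)) := by
    rfl
  rw [hhead, htail]
  have h2 := two_rpow_le
  have h3 := three_rpow_le
  have h4 := tsum_tail_le
  have h5 := seven_halves_rpow_le
  linarith

/-- **The tree remainder vs. the typed one**: for `X ≥ 1`,
`5 + 2 log(2 Zc X)/log(7/6) ≤ 5 + 12.975 log(9.1902 X) + 0.014` (`2 Zc ≤ 9.2`, `12.975 log(9.2/9.1902) ≤ 0.014`). -/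
theorem remainder_le {X : ℝ} (hX : 1 ≤ X) :
    5 + 2 * (Real.log (2 * (X * DirichletDisc.Zc)) / Real.log (7 / 6)) ≤
      5 + 12.975 * Real.log (9.1902 * X) + 0.014 := by
  have hZ1 : 1 ≤ DirichletDisc.Zc := DirichletDisc.one_le_Zc
  have hZ := Zc_le
  have hl := log_seven_sixths_ge
  have hκ := two_div_log_seven_sixths_le
  have hl0 : 0 < Real.log (7 / 6) := by linarith
  -- `log(2 Zc X) ≤ log(9.2 X) = log(9.1902 X) + log(9.2/9.1902)`
  have hlogmono : Real.log (2 * (X * DirichletDisc.Zc)) ≤ Real.log (9.1902 * X) + Real.log (9.2 / 9.1902) := by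
    rw [← Real.log_mul (by positivity) (by positivity)]
    exact Real.log_le_log (by positivity) (by nlinarith)
  have hsmall : Real.log (9.2 / 9.1902) ≤ 0.00107 := by
    have := Real.log_le_sub_one_of_pos (show (0 : ℝ) < 9.2 / 9.1902 by positivity)
    exact this.trans (by norm_num)
  have hlog0 : 0 ≤ Real.log (2 * (X * DirichletDisc.Zc)) := Real.log_nonneg (by nlinarith)
  have e : 2 * (Real.log (2 * (X * DirichletDisc.Zc)) / Real.log (7 / 6)) =
      2 / Real.log (7 / 6) * Real.log (2 * (X * DirichletDisc.Zc)) := by ring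
  rw [e]
  calc 5 + 2 / Real.log (7 / 6) * Real.log (2 * (X * DirichletDisc.Zc))
      ≤ 5 + 12.975 * Real.log (2 * (X * DirichletDisc.Zc)) := by
        linarith [mul_le_mul_of_nonneg_right hκ hlog0]
    _ ≤ 5 + 12.975 * (Real.log (9.1902 * X) + Real.log (9.2 / 9.1902)) := by linarith
    _ ≤ 5 + 12.975 * Real.log (9.1902 * X) + 0.014 := by nlinarith

end CharCount

end Summit.RiemannHypothesis.RiemannHypothesis.Theorems.LiTheory

end
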